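import Summits.Ventures.Crystal3D.Theorems.StickyWulffConstantPolycrystalWulffBoundSubfamilyPerimeter
import Summits.Ventures.Crystal3D.Theorems.StickyWulffConstantPolycrystalWulffBoundMergingCalculus

/-!
# `PolycrystalWulffBound`, line `PolyDensity`: the LP row ISO for a block of grains

Route `StickyWulffConstant` of the venture `Summits/Ventures/Crystal3D`, crux `PolycrystalWulffBound`
(item `stmt-Ventures-19482`), second prover lane (poly-p2, gen 4).  Companion of `…BlockRows`: the
isoperimetric row of the middle-band LP (HOME/poly-p2/MIDDLE-BAND-g4.md §8) for ONE Finset `B` of grains,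
in the LP's variables — the free Euclidean areas `Y_f` and the Euclidean interfaces
`w f g = ι_{B̄(0,1)}(G f, G g)`:

* `blockPerimeter_eq` — `Per(⋃_{f∈B} G f) = Σ_{f∈B} Y_f + Σ_{f∈B} Σ_{g∉B} w f g`
  (inclusion–exclusion `per_biUnion_eq_sum_sub_sum_iota` for the unit ball);
* `iso_le_block` — `3(4π/3)^{1/3}·|⋃_{f∈B} G f|^{2/3} ≤ Σ_{f∈B} Y_f + Σ_{f∈B} Σ_{g∉B} w f g`.
WHAT THIS IS NOT: the block Wulff / floor / recolouring rows; a rung; F-C1 not moved.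
-/

noncomputable section

namespace Summit.Ventures.Crystal3D.Theorems

open MeasureTheory Set Metric
open scoped RealInnerProductSpace ENNReal Pointwise
open Summit.Ventures.Crystal3D.Cruxes.TextureLiminf.TexShadow
open Literature.Analysis.Convexity
open Literature.MathematicalPhysics.StatisticalMechanics (perimeter HasFinitePerimeter)

/-- **Perimeter of a block in LP variables**: `Per(⋃_{f∈B} G f) = Σ_{f∈B} Y_f + Σ_{f∈B} Σ_{g∉B} w f g`,
with `Y_f = per_{B̄(0,1)}(G f) − Σ_{g ≠ f} w f g` the free Euclidean area of grain `f`. -/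
theorem blockPerimeter_eq {n : ℕ} (G : Fin n → Set E3)
    (hPoly : ∀ f, ∃ (k : ℕ) (H : Fin k → Finset (E3 × ℝ)), G f = ⋃ i, polytope (H i))
    (hvol : ∀ f, volume (G f) < ⊤) (hdisjG : ∀ f g, f ≠ g → Disjoint (G f) (G g))
    (B : Finset (Fin n)) :
    (perimeter (⋃ f ∈ B, G f)).toReal =
      (∑ f ∈ B, (per (closedBall (0 : E3) 1) (G f) - ∑ g, (if f = g then 0 else
        (per (closedBall (0 : E3) 1) (G f) + per (closedBall (0 : E3) 1) (G g) -
          per (closedBall (0 : E3) 1) (G f ∪ G g)) / 2))) +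
      ∑ f ∈ B, ∑ g ∈ Finset.univ \ B, (per (closedBall (0 : E3) 1) (G f) +
        per (closedBall (0 : E3) 1) (G g) - per (closedBall (0 : E3) 1) (G f ∪ G g)) / 2 := by
  classical
  have hBc : IsCompact (closedBall (0 : E3) 1) := isCompact_closedBall 0 1
  have hBv : Convex ℝ (closedBall (0 : E3) 1) := convex_closedBall 0 1
  have hB0 : (0 : E3) ∈ closedBall (0 : E3) 1 := mem_closedBall_self zero_le_one
  have hBs : -closedBall (0 : E3) 1 = closedBall 0 1 := by rw [neg_closedBall, neg_zero]
  set T : Fin n → Fin n → ℝ := fun f g => if f = g then 0 else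
    (per (closedBall (0 : E3) 1) (G f) + per (closedBall (0 : E3) 1) (G g) -
      per (closedBall (0 : E3) 1) (G f ∪ G g)) / 2 with hT
  rw [← one_mul (perimeter (⋃ f ∈ B, G f)).toReal, ← per_closedBall_eq_mul_perimeter one_pos,
    per_biUnion_eq_sum_sub_sum_iota G hPoly hvol hdisjG hBc hBv hB0 hBs B]
  -- split each grain's interface sum over `B` and its complement
  have hsplit : ∀ f, (∑ g, T f g) = (∑ g ∈ B, T f g) + ∑ g ∈ Finset.univ \ B, T f g := by
    intro f
    rw [← Finset.sum_union Finset.disjoint_sdiff, Finset.union_sdiff_of_subset (Finset.subset_univ B)]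
  have hoff : ∀ f ∈ B, ∀ g ∈ Finset.univ \ B, T f g =
      (per (closedBall (0 : E3) 1) (G f) + per (closedBall (0 : E3) 1) (G g) -
        per (closedBall (0 : E3) 1) (G f ∪ G g)) / 2 := by
    intro f hf g hg
    have hfg : f ≠ g := fun h => (Finset.mem_sdiff.1 hg).2 (h ▸ hf)
    simp only [hT, hfg, if_false]
  have h1 : (∑ f ∈ B, (per (closedBall (0 : E3) 1) (G f) - ∑ g, T f g)) =
      (∑ f ∈ B, per (closedBall (0 : E3) 1) (G f)) - (∑ f ∈ B, ∑ g ∈ B, T f g) -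
        ∑ f ∈ B, ∑ g ∈ Finset.univ \ B, T f g := by
    rw [Finset.sum_sub_distrib, Finset.sum_congr rfl fun f _ => hsplit f, Finset.sum_add_distrib]
    ring
  have h2 : (∑ f ∈ B, ∑ g ∈ Finset.univ \ B, (per (closedBall (0 : E3) 1) (G f) +
      per (closedBall (0 : E3) 1) (G g) - per (closedBall (0 : E3) 1) (G f ∪ G g)) / 2) =
      ∑ f ∈ B, ∑ g ∈ Finset.univ \ B, T f g :=
    Finset.sum_congr rfl fun f hf => Finset.sum_congr rfl fun g hg => (hoff f hf g hg).symm
  rw [h1, h2]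
  ring

/-- **Row «iso(B)»**: the Euclidean isoperimetric inequality for a block, in LP variables. -/
theorem iso_le_block {n : ℕ} (G : Fin n → Set E3)
    (hfin : ∀ f, HasFinitePerimeter (G f) ∧ volume (G f) < ⊤)
    (hPoly : ∀ f, ∃ (k : ℕ) (H : Fin k → Finset (E3 × ℝ)), G f = ⋃ i, polytope (H i))
    (hdisjG : ∀ f g, f ≠ g → Disjoint (G f) (G g)) (B : Finset (Fin n)) :
    3 * (Real.pi * 4 / 3) ^ ((1 : ℝ) / 3) * (volume (⋃ f ∈ B, G f)).toReal ^ ((2 : ℝ) / 3) ≤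
      (∑ f ∈ B, (per (closedBall (0 : E3) 1) (G f) - ∑ g, (if f = g then 0 else
        (per (closedBall (0 : E3) 1) (G f) + per (closedBall (0 : E3) 1) (G g) -
          per (closedBall (0 : E3) 1) (G f ∪ G g)) / 2))) +
      ∑ f ∈ B, ∑ g ∈ Finset.univ \ B, (per (closedBall (0 : E3) 1) (G f) +
        per (closedBall (0 : E3) 1) (G g) - per (closedBall (0 : E3) 1) (G f ∪ G g)) / 2 := by
  have hvol : ∀ f, volume (G f) < ⊤ := fun f => (hfin f).2
  obtain ⟨hmeas, hvolB, hperB, -⟩ := subfamily_union_facts G hfin hdisjG B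
  rw [← blockPerimeter_eq G hPoly hvol hdisjG B]
  exact isoperimetric_toReal_three hmeas hvolB hperB

end Summit.Ventures.Crystal3D.Theorems

end
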